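import Summits.BirchSwinnertonDyer.Rank1Residual.Additive.CyclotomicTowerSignedSelmerDual
import Literature.NumberTheory.EllipticCurves.PAdicBSD
import Literature.NumberTheory.EllipticCurves.GeomPointsGaloisModule
import Literature.NumberTheory.GaloisRepresentations.LocalKroneckerWeberInertiaProofs
import HarnessLib

/-!
# The restricted tower `κ|_{Γ_F}`: the `ℤ_p`-extension `F·ℚ_∞ / F` of a number field `F` cut out by a
# `ℤ_p`-extension `κ` of `ℚ` (cyclotomic if `κ` is), its kernel and layers as the preimages of
# cc-typer-6's tower subgroups, its generator and the cyclotomic-variable clause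
(cell `bsd-potss`, seat `bsd-potss-ctrl` g2; T-e2-R1⁺ piece (i), brick (i-b): the `κF`, `γF` and
`ζ`-clause binders of the typed (C1_η) `QuadraticBranchPlusMainConjectureAt` produced from the
consumer's `κ`, `γ`; TARGET.md v6 §0.12 (e) piece (i))

HONEST FRAMING (cell `bsd-potss`, run/shared/lean/pub/bsd-potss/; FULL-BSD rank ≤ 1 programme,
tranche 1b): INFRASTRUCTURE — ONE transparent definition (`restrictGal`, the composite `κ ∘ res`) +
THEOREMS; no named Literature fact, no `Prop` definition, no `sorry`, axioms standard; nothing is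
booked; no label / mark / count moves; nothing about (C1_η) or `BSD(W, p)` is claimed.

## What (`F` a number field, `κ : ZpExtension ℚ p` ONTO on `Gal(ℚ̄/F)` — `hκ₀`, true whenever
## `p ∤ [F:ℚ]`, tree `kappa_surjOn_galRange_of_coprime_finrank`)
* `restrictGal F κ hκ₀ : ZpExtension F p`, `σ ↦ κ(σ|_{ℚ̄})`;
* `mem_kerSubgroup_restrictGal_iff` / `mem_layerSubgroup_restrictGal_iff`: `ker = res⁻¹(towerTopSubgroup κ F)`,
  `layer n = res⁻¹(towerSubgroup κ F n)` (also as `Subgroup.comap` identities);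
* `isCyclotomic_restrictGal` (`χ_p^F = χ_p^ℚ ∘ res`, tree `cyclotomicCharacter_absGaloisRestrict`);
* `isTopGenerator_restrictGal_iff`; `exists_zeta_of_isCyclotomicVariable` — the `ζ`-clause of
  (C1_η) for `γF` from `IsCyclotomicVariable p (res γF)`.

References: [Washington1997] §13.1 (the cyclotomic `ℤ_p`-extension of a number field);
[SerreGaloisCohomology1997] II.§1.1; [Kobayashi2003] §2 p. 4 (`K_∞ = K₀ℚ_∞`), §3 p. 5 (`γ ↔ 1 + X`).
-/

noncomputable section

open scoped Classical

open Field

namespace Summit.BirchSwinnertonDyer.Rank1Residual.Additive.BaseChange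

open Literature.NumberTheory.EllipticCurves Literature.NumberTheory.GaloisRepresentations ZpExtension

variable (F : Type) [Field F] [NumberField F] {p : ℕ} [Fact p.Prime] (κ : ZpExtension ℚ p)
  (hκ₀ : ∀ x : Multiplicative ℤ_[p], ∃ g ∈ galRange (K := ℚ) F, κ g = x)

/-- **The restricted tower `κ|_{Γ_F} : Γ_F → ℤ_p`, `σ ↦ κ(σ|_{ℚ̄})`** — a `ℤ_p`-extension of `F` (onto
because `κ` is onto on `Gal(ℚ̄/F)`): its top field is `F·ℚ_∞^κ`. [cite: Washington1997, §13.1] -/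
def restrictGal : ZpExtension F p where
  toContinuousMonoidHom := κ.toContinuousMonoidHom.comp (resGal (K := ℚ) F)
  surjective x := by
    obtain ⟨g, hg, hx⟩ := hκ₀ x
    obtain ⟨σ, rfl⟩ := (mem_galRange_iff F g).mp hg
    exact ⟨σ, hx⟩

/-- Values of the restricted tower. [folklore] -/
@[simp]
theorem restrictGal_apply (σ : absoluteGaloisGroup F) :
    restrictGal F κ hκ₀ σ = κ (resGal (K := ℚ) F σ) :=
  rfl

/-- `σ ∈ ker κ|_{Γ_F} ↔ σ|_{ℚ̄} ∈ Gal(ℚ̄/F·ℚ_∞) = towerTopSubgroup κ F`. [cite: Kobayashi2003, §2 p. 4] -/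
theorem mem_kerSubgroup_restrictGal_iff (σ : absoluteGaloisGroup F) :
    σ ∈ (restrictGal F κ hκ₀).kerSubgroup ↔ resGal (K := ℚ) F σ ∈ towerTopSubgroup κ F := by
  rw [mem_kerSubgroup, mem_towerTopSubgroup_iff, mem_kerSubgroup, restrictGal_apply]
  exact ⟨fun h ↦ ⟨h, σ, rfl⟩, fun h ↦ h.1⟩

/-- `ker κ|_{Γ_F} = res⁻¹ (towerTopSubgroup κ F)`. [cite: Kobayashi2003, §2 p. 4] -/
theorem kerSubgroup_restrictGal :
    (restrictGal F κ hκ₀).kerSubgroup = (towerTopSubgroup κ F).comap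
      ((resGal (K := ℚ) F : absoluteGaloisGroup F →ₜ* absoluteGaloisGroup ℚ) :
        absoluteGaloisGroup F →* absoluteGaloisGroup ℚ) := by
  ext σ
  exact mem_kerSubgroup_restrictGal_iff F κ hκ₀ σ

/-- `σ ∈ (κ|_{Γ_F})⁻¹(pⁿℤ_p) ↔ σ|_{ℚ̄} ∈ Gal(ℚ̄/F·ℚ_n) = towerSubgroup κ F n`. [cite: Kobayashi2003, §2 p. 4] -/
theorem mem_layerSubgroup_restrictGal_iff (n : ℕ) (σ : absoluteGaloisGroup F) :
    σ ∈ (restrictGal F κ hκ₀).layerSubgroup n ↔ resGal (K := ℚ) F σ ∈ towerSubgroup κ F n := by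
  rw [mem_layerSubgroup, mem_towerSubgroup_iff, mem_layerSubgroup, restrictGal_apply]
  exact ⟨fun h ↦ ⟨h, σ, rfl⟩, fun h ↦ h.1⟩

/-- `(κ|_{Γ_F})⁻¹(pⁿℤ_p) = res⁻¹ (towerSubgroup κ F n)`. [cite: Kobayashi2003, §2 p. 4] -/
theorem layerSubgroup_restrictGal (n : ℕ) :
    (restrictGal F κ hκ₀).layerSubgroup n = (towerSubgroup κ F n).comap
      ((resGal (K := ℚ) F : absoluteGaloisGroup F →ₜ* absoluteGaloisGroup ℚ) :
        absoluteGaloisGroup F →* absoluteGaloisGroup ℚ) := by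
  ext σ
  exact mem_layerSubgroup_restrictGal_iff F κ hκ₀ n σ

/-- **`κ|_{Γ_F}` is the CYCLOTOMIC `ℤ_p`-extension of `F` when `κ` is that of `ℚ`**: `ker κ|_{Γ_F} =
res⁻¹(χ_p⁻¹ μ) = (χ_p^F)⁻¹ μ` since `χ_p^F = χ_p^ℚ ∘ res` (tree `cyclotomicCharacter_absGaloisRestrict`).
[cite: Washington1997, §13.1] -/
theorem isCyclotomic_restrictGal (hκ : κ.IsCyclotomic) : (restrictGal F κ hκ₀).IsCyclotomic := by
  rw [ZpExtension.IsCyclotomic] at hκ ⊢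
  ext σ
  haveI : NeZero (p : ℚ) := ⟨by exact_mod_cast (Fact.out : p.Prime).ne_zero⟩
  rw [mem_kerSubgroup, restrictGal_apply, ← mem_kerSubgroup, hκ, Subgroup.mem_comap, Subgroup.mem_comap]
  change GaloisRep.cyclotomicCharacter ℚ p (absGaloisRestrict ℚ F σ) ∈ CommGroup.torsion ℤ_[p]ˣ ↔
    GaloisRep.cyclotomicCharacter F p σ ∈ CommGroup.torsion ℤ_[p]ˣ
  rw [cyclotomicCharacter_absGaloisRestrict]

/-- `γF` generates `κ|_{Γ_F}` topologically iff `γF|_{ℚ̄}` generates `κ`. [cite: Kobayashi2003, §3 p. 5] -/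
theorem isTopGenerator_restrictGal_iff (γF : absoluteGaloisGroup F) :
    (restrictGal F κ hκ₀).IsTopGenerator γF ↔ κ.IsTopGenerator (resGal (K := ℚ) F γF) :=
  Iff.rfl

/-- **The cyclotomic-variable clause of (C1_η) for `γF`**: if `γF|_{ℚ̄}` satisfies
`IsCyclotomicVariable p` (`χ_p(γ)·ζ = 1 + p` for a root of unity `ζ`), then so does `γF` for the
cyclotomic character of `F`. [cite: Kobayashi2003, §3 p. 5 (γ ↔ 1 + X)] -/
theorem exists_zeta_of_isCyclotomicVariable {γF : absoluteGaloisGroup F}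
    (h : IsCyclotomicVariable p (resGal (K := ℚ) F γF)) :
    ∃ ζ : ℤ_[p]ˣ, IsOfFinOrder ζ ∧
      ((GaloisRep.cyclotomicCharacter F p γF * ζ : ℤ_[p]ˣ) : ℤ_[p]) = (cyclotomicGenerator p : ℤ_[p]) := by
  haveI : NeZero (p : ℚ) := ⟨by exact_mod_cast (Fact.out : p.Prime).ne_zero⟩
  obtain ⟨ζ, hζ, hγ⟩ := h
  refine ⟨ζ, hζ, ?_⟩
  rw [← cyclotomicCharacter_absGaloisRestrict ℚ F p γF, ← WeierstrassCurve.resGal_eq_absGaloisRestrict]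
  exact hγ

/-- **A generator on the `F`-side**: from the consumer's `γ` (`κ γ = 1`) and `κ(Gal(ℚ̄/F)) = ℤ_p`,
a `γF ∈ Γ_F` with `κ(γF|_{ℚ̄}) = κ γ` — so `γF` generates `κ|_{Γ_F}`, `γ⁻¹·γF|_{ℚ̄} ∈ ker κ`, and
`γF|_{ℚ̄} ∈ Gal(ℚ̄/F)`. [cite: Kobayashi2003, §3 p. 5] -/
theorem exists_generator_restrictGal {γ : absoluteGaloisGroup ℚ} (hγ : κ.IsTopGenerator γ) :
    ∃ γF : absoluteGaloisGroup F, (restrictGal F κ hκ₀).IsTopGenerator γF ∧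
      γ⁻¹ * resGal (K := ℚ) F γF ∈ κ.kerSubgroup ∧ resGal (K := ℚ) F γF ∈ galRange (K := ℚ) F := by
  obtain ⟨g, hg, hgκ⟩ := hκ₀ (κ γ)
  obtain ⟨γF, rfl⟩ := (mem_galRange_iff F g).mp hg
  refine ⟨γF, ?_, ?_, hg⟩
  · rw [isTopGenerator_restrictGal_iff, ZpExtension.IsTopGenerator, hgκ]
    exact hγ
  · rw [mem_kerSubgroup, map_mul, map_inv, hgκ, inv_mul_cancel]

end Summit.BirchSwinnertonDyer.Rank1Residual.Additive.BaseChange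

end
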